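import Mathlib

/-!
# Crux `CoreGluingGivenInvertibilityQR`, line `Sketch`, stub `stub_qrHydraulicLaw` — hydraulic law of a slender core end

Along a slender core end of the filament skeleton (rotated Leray frame, `TransverseReductionR`), write `A` for the
core area, `V` for the axis velocity and `w` for the ambient tangential speed, all functions of arclength.  The
volume budget `(A V)′ = (3/2) A + 4` and the axis head law `Cκ² (1/A)′ = V V′ − w w′` combine, at any point where
`A ≠ 0`, into the quasi-one-dimensional hydraulic law
`(c₀² − V²) V′ = c₀² (3/2 + 4/A) − V (w w′)`, `c₀² = Cκ²/A`.

This file is that pointwise calculus step: expand the product and the inverse by `deriv_fun_mul` /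
`deriv_fun_inv''` and close the resulting field identity by `linear_combination`, feeding it the single
cancellation `A τ · (A τ)⁻¹ = 1`.  Pure Mathlib.
-/

set_option linter.dupNamespace false

noncomputable section

namespace Summit.NavierStokesRegularity.NavierStokesRegularity.Theorems

open MeasureTheory Real Set Filter Topology
open scoped InnerProductSpace

/-- **Hydraulic law of a slender core end.** From the volume budget `(A V)′ = (3/2)A + 4` and the axis head
law `Cκ² (1/A)′ = V V′ − w w′` at a point where `A, V ≠ 0`:
`(Cκ²/A − V²) V′ = (Cκ²/A)(3/2 + 4/A) − V (w w′)`. [folklore] -/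
theorem stub_qrHydraulicLaw :
    ∀ (Cκ2 : ℝ) (V A w : ℝ → ℝ) (τ : ℝ), DifferentiableAt ℝ V τ → DifferentiableAt ℝ A τ →
      DifferentiableAt ℝ w τ → A τ ≠ 0 → V τ ≠ 0 →
      deriv (fun s => A s * V s) τ = 3/2 * A τ + 4 →
      Cκ2 * deriv (fun s => (A s)⁻¹) τ = V τ * deriv V τ - w τ * deriv w τ →
      (Cκ2 / A τ - V τ ^ 2) * deriv V τ = Cκ2 / A τ * (3/2 + 4 / A τ) - V τ * (w τ * deriv w τ) := by
  intro Cκ2 V A w τ hV hA _hw hA0 _hV0 h1 h2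
  rw [deriv_fun_mul hA hV] at h1
  rw [deriv_fun_inv'' hA hA0] at h2
  have hinv : A τ * (A τ)⁻¹ = 1 := mul_inv_cancel₀ hA0
  linear_combination V τ * h2 + (Cκ2 * (A τ)⁻¹ ^ 2) * h1
    + (3 / 2 * Cκ2 * (A τ)⁻¹ - Cκ2 * (A τ)⁻¹ * deriv V τ) * hinv

end Summit.NavierStokesRegularity.NavierStokesRegularity.Theorems
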